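import Literature.AlgebraicGeometry.GroupSchemes.BTGroupFixedPartRankOfPointCount
import Literature.AlgebraicGeometry.GroupSchemes.BTGroupRingActionCompletion
import Literature.AlgebraicGeometry.AbelianSchemes.PDivisibleGroupRingAction
import Literature.AlgebraicGeometry.AbelianSchemes.AbelianSchemeFixedPowBaseChange
import HarnessLib

/-!
# The height of the `w`-block of `A[p^∞]` on the special fibre from a point count at the generic geometric fibre
# (Tate, *p-divisible groups* §2 (2.1), (2.4); Messing, LNM 264, Ch. I (1.1)–(1.6); Rapoport–Smithling–Zhang §4.1)

Layer `Literature/AlgebraicGeometry/AbelianSchemes`, namespace `Literature.AlgebraicGeometry.AbelianSchemes` (+ `AbelianSchemeOver`,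
`AbelianSchemeOver.RingAction`).  Cell `hodgecm-mathlib` (D-0151), FLOOR 0, P6 «MOD programme», DEAL 5 (S-H-BT) FILE B — the socket (S-H)
`hrank` of the K∕BT cut (F0P6d-plan (g2) KBT-CUT v2.3 §1; consumer ★ `PDivisibleGroupBlockDocking`) in the currency of the SPECIAL FIBRE;
`--supports stmt-HodgeConjecture-24832`; COUNT-NEUTRAL — HC_CM is proved only modulo the 2 remaining named inputs (hLiu418 24832, h413 24833)
until rung 0 closes; this file discharges none of them.  THEOREMS ONLY (no definition, no instance, no named fact, no `sorry`).

Setting: `𝒜` an abelian scheme over a LOCAL base `Spec R₀` with a ring action `act : RingAction O 𝒜`, `p ≠ 0`, and a `p`-adically compatible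
family `a : ℕ → O` with `aₙ² ≡ aₙ (mod pⁿ)` (the CRT family of the `w`-block idempotent `e_w`, ★ `BlockIdempotentFamily`); `ε₀ := β₀(a)` is the
idempotent endomorphism of `𝒜[p^∞]` it defines (★ `IsRingActionBT.homOfCompatibleFamily` over ★ `isRingActionBT_pDivisibleGroupMap`, DEAL 3).
For a base change `g : Spec K → Spec R₀` the special (or generic) fibre `𝒜_K := 𝒜 ×_{R₀} K` carries `act.baseChange g` and its own idempotent
`ε_K` on `𝒜_K[p^∞]`; the layers `𝒜[pⁿ] ×_{R₀} K ≅ 𝒜_K[pⁿ]` (two kernels of `[pⁿ]` on `𝒜 ×_{R₀} K`) are identified compatibly with `ε₀ ×_{R₀} K`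
and `ε_K` (§2–§3), so fixed points and fixed-part ranks agree (§1).  FILE A (★ `BTGroupFixedPartRankOfPointCount`) turns an `Ω`-point count
of the `ε₀`-fixed points at a geometric point `gΩ` with `(p : Ω) ≠ 0` into `hrank` on `Spec R₀`; ★ `hrank_baseChange` moves it to `Spec κ`.
* §1 `comp_eq_comp_of_restrict` (two endomorphisms restricting ONE endomorphism of `M` along compatible monomorphisms are intertwined),
  `natCard_fixedPoints_eq_of_iso` (intertwined endomorphisms have equinumerous fixed `T`-points),
  **`finrank_fix_hom_eq_of_iso`** (… and fixed subschemes of equal rank, ★ `IdempotentSplitting.fixMap`, Mathlib `finrank_comp_left_of_isIso`).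
* §2 **`AbelianSchemeOver.exists_iso_pullback_torsion`** — `𝒜[N] ×_S S′ ≅ (𝒜 ×_S S′)[N]` over `𝒜 ×_S S′` (both are `Ker [N]`).
* §3 `RingAction.exists_iso_pullback_torsion_comm_torsionMap` — the same isomorphism intertwines `(act.i r)[N] ×_S S′` and `((act ×_S S′).i r)[N]`.
* §4 **`RingAction.hrank_specialFibre_of_natCard_fixedPoints`** — THE SOCKET (S-H): `#{x ∈ 𝒜_Ω[pⁿ](Ω) | x ∘ e_w = x} = p^{n h}` for all `n`
  at a geometric point `gΩ` with `(p : Ω) ≠ 0` ⟹ `rk (Fix ε_κ)_n = p^{n h}` on `Spec κ` for EVERY field-valued point `gκ` of `Spec R₀`,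
  `ε_κ := (isRingActionBT_pDivisibleGroupMap (act.baseChange gκ) …).homOfCompatibleFamily a ha` — the binder `hrank` of ★ `PDivisibleGroupBlockDocking`
  for `A := 𝒜.baseChange gκ`, `act := act.baseChange gκ`; also `RingAction.hrank_of_natCard_fixedPoints` (the same on `Spec R₀` itself).

## References
* [Tate1967] J. T. Tate, *p-divisible groups* (Driebergen 1966), Springer 1967 — §2 (2.1), (2.4).
* [Messing1972] W. Messing, *The Crystals Associated to Barsotti–Tate Groups*, LNM 264 (1972) — Ch. I (1.1)–(1.6).
* [RapoportSmithlingZhang2020Diagonal] M. Rapoport, B. Smithling, W. Zhang, *Arithmetic diagonal cycles on unitary Shimura varieties* (2020) — §4.1.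
* [GortzWedhorn2020] U. Görtz, T. Wedhorn, *Algebraic Geometry I*, 2nd ed. (2020) — Definition 4.45 (2) p. 117, Section (4.7).
* [GortzWedhorn2023] U. Görtz, T. Wedhorn, *Algebraic Geometry II* (2023) — Prop. 27.188 (1).
* [StacksProject] The Stacks Project — Tag 02KA.
* [Kottwitz1992] R. Kottwitz, *Points on some Shimura varieties over finite fields*, JAMS 5 (1992) — §5 (p. 390).
-/

noncomputable section

-- `(B.baseChange g).G n = (Over.pullback g).obj (B.G n)`, `(A.baseChange g).X = (Over.pullback g).obj A.X`, `A.mulN N = (𝟙 A.X) ^ N`,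
-- `(pDivisibleGroupMap f …).app n = torsionMap f (p ^ n)` are definitional only above `instances` transparency (as in ★
-- `BarsottiTateGroupFixedPartBaseChange`, ★ `GroupSchemeKernelBaseChange`).
set_option backward.isDefEq.respectTransparency false

universe u v

open CategoryTheory CategoryTheory.Limits AlgebraicGeometry MonoidalCategory CartesianMonoidalCategory
open scoped MonObj CategoryTheory.Obj

namespace Literature.AlgebraicGeometry.AbelianSchemes

open Literature.AlgebraicGeometry.GroupSchemes Literature.AlgebraicGeometry.GroupSchemes.IdempotentSplitting
open Literature.AlgebraicGeometry.GroupSchemes.BTGroup Literature.AlgebraicGeometry.GroupSchemes.BTGroup.Hom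
open Literature.AlgebraicGeometry.GroupSchemes.IsRingActionBT

/-! ## §1 Intertwined endomorphisms: fixed points and fixed parts agree -/

/-- **Restrictions of one endomorphism are intertwined.**  If `ε` on `G` and `ε′` on `G′` both restrict the same endomorphism `ψ` of `M`
along `i : G → M` and a monomorphism `i′ : G′ → M` (`ε ≫ i = i ≫ ψ`, `ε′ ≫ i′ = i′ ≫ ψ`), then any `φ : G → G′` over `M` (`φ ≫ i′ = i`)
satisfies `φ ≫ ε′ = ε ≫ φ`. [cite: GortzWedhorn2020, Definition 4.45 (2), p. 117] -/
theorem comp_eq_comp_of_restrict {C : Type*} [Category C] {G G' M : C} {ε : G ⟶ G} {ε' : G' ⟶ G'} {ψ : M ⟶ M} {i : G ⟶ M}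
    {i' : G' ⟶ M} [Mono i'] (φ : G ⟶ G') (hφ : φ ≫ i' = i) (hε : ε ≫ i = i ≫ ψ) (hε' : ε' ≫ i' = i' ≫ ψ) :
    φ ≫ ε' = ε ≫ φ := by
  rw [← cancel_mono i']
  calc (φ ≫ ε') ≫ i' = φ ≫ (ε' ≫ i') := Category.assoc _ _ _
    _ = φ ≫ (i' ≫ ψ) := by rw [hε']
    _ = (φ ≫ i') ≫ ψ := (Category.assoc _ _ _).symm
    _ = i ≫ ψ := by rw [hφ]
    _ = ε ≫ i := hε.symm
    _ = ε ≫ (φ ≫ i') := by rw [hφ]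
    _ = (ε ≫ φ) ≫ i' := (Category.assoc _ _ _).symm

/-- An isomorphism intertwining `ε` and `ε′` also intertwines them backwards: `φ⁻¹ ≫ ε = ε′ ≫ φ⁻¹`. [cite: GortzWedhorn2020, Definition 4.45 (2), p. 117] -/
theorem inv_comp_eq_comp_inv_of_hom_comp {C : Type*} [Category C] {G G' : C} {ε : G ⟶ G} {ε' : G' ⟶ G'} (φ : G ≅ G')
    (hφ : φ.hom ≫ ε' = ε ≫ φ.hom) : φ.inv ≫ ε = ε' ≫ φ.inv := by
  rw [CategoryTheory.Iso.inv_comp_eq, ← Category.assoc, hφ, Category.assoc, φ.hom_inv_id, Category.comp_id]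

/-- **Intertwined endomorphisms have equinumerous fixed `T`-valued points**: if `φ : G ≅ G′` satisfies `φ ≫ ε′ = ε ≫ φ`, then
`x ↦ x ≫ φ` is a bijection `{x : T → G | x ≫ ε = x} ≃ {y : T → G′ | y ≫ ε′ = y}`. [cite: GortzWedhorn2020, Definition 4.45 (2), p. 117] -/
theorem natCard_fixedPoints_eq_of_iso {C : Type*} [Category C] {G G' : C} (T : C) {ε : G ⟶ G} {ε' : G' ⟶ G'} (φ : G ≅ G')
    (hφ : φ.hom ≫ ε' = ε ≫ φ.hom) :
    Nat.card {x : T ⟶ G // x ≫ ε = x} = Nat.card {y : T ⟶ G' // y ≫ ε' = y} := by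
  have hφ' : φ.inv ≫ ε = ε' ≫ φ.inv := inv_comp_eq_comp_inv_of_hom_comp φ hφ
  exact Nat.card_congr
    { toFun := fun x => ⟨x.1 ≫ φ.hom, by rw [Category.assoc, hφ, ← Category.assoc, x.2]⟩
      invFun := fun y => ⟨y.1 ≫ φ.inv, by rw [Category.assoc, hφ', ← Category.assoc, y.2]⟩
      left_inv := fun x => Subtype.ext (by simp)
      right_inv := fun y => Subtype.ext (by simp) }

/-- **Intertwined idempotents have fixed subschemes of EQUAL RANK**: for `S`-group schemes `G`, `G′`, endomorphisms `ε`, `ε′` (`ε′` idempotent,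
`G′ → S` finite flat) and an isomorphism `φ : G ≅ G′` of `S`-schemes with `φ ≫ ε′ = ε ≫ φ`, the fixed subschemes `Fix ε ≅ Fix ε′`
(★ `IdempotentSplitting.fixMap` both ways) have the same rank at every `s ∈ S` (Mathlib `Scheme.Hom.finrank_comp_left_of_isIso`).
[cite: GortzWedhorn2020, Definition 4.45 (2), p. 117] [cite: StacksProject, Tag 02KA] -/
theorem finrank_fix_hom_eq_of_iso {S : Scheme.{u}} {G G' : Over S} [GrpObj G] [GrpObj G'] (ε : G ⟶ G) (ε' : G' ⟶ G') (φ : G ≅ G')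
    (hφ : φ.hom ≫ ε' = ε ≫ φ.hom) (hε' : ε' ≫ ε' = ε') [IsFinite G'.hom] [Flat G'.hom] (s : S) :
    (fix ε).hom.finrank s = (fix ε').hom.finrank s := by
  have hφ' : φ.inv ≫ ε = ε' ≫ φ.inv := inv_comp_eq_comp_inv_of_hom_comp φ hφ
  have h1 : fixMap ε ε' φ.hom hφ ≫ fixMap ε' ε φ.inv hφ' = 𝟙 _ :=
    fix_hom_ext ε (by rw [Category.assoc, fixMap_ι, fixMap_ι_assoc, φ.hom_inv_id, Category.comp_id, Category.id_comp])
  have h2 : fixMap ε' ε φ.inv hφ' ≫ fixMap ε ε' φ.hom hφ = 𝟙 _ :=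
    fix_hom_ext ε' (by rw [Category.assoc, fixMap_ι, fixMap_ι_assoc, φ.inv_hom_id, Category.comp_id, Category.id_comp])
  let e : fix ε ≅ fix ε' := ⟨fixMap ε ε' φ.hom hφ, fixMap ε' ε φ.inv hφ', h1, h2⟩
  haveI : IsIso e.hom.left := inferInstanceAs (IsIso ((Over.forget S).mapIso e).hom)
  haveI : IsFinite (fix ε').hom := isFinite_fix_hom ε'
  haveI : Flat (fix ε').hom := flat_fix_hom ε' hε'
  rw [← Over.w e.hom, Scheme.Hom.finrank_comp_left_of_isIso]

/-! ## §2 `𝒜[N] ×_S S′ ≅ (𝒜 ×_S S′)[N]` -/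

namespace AbelianSchemeOver

variable {S S' : Scheme.{u}} (A : AbelianSchemeOver S) (g : S' ⟶ S)

/-- **Torsion commutes with base change**: `𝒜[N] ×_S S′ ≅ (𝒜 ×_S S′)[N]` over `𝒜 ×_S S′` — both are the kernel of `[N]` on `𝒜 ×_S S′`
(the base-changed cartesian square ★ `isPullback_map_of_isPullback_unit` of ★ `isPullback_torsionι`, with
`[N]_𝒜 ×_S S′ = [N]_{𝒜 ×_S S′}` by ★ `pullback_map_pow`, against ★ `isPullback_torsionι` of `𝒜 ×_S S′`; Mathlib `IsPullback.isoIsPullback`).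
[cite: GortzWedhorn2023, Prop. 27.188 (1)] [cite: GortzWedhorn2020, Section (4.7) (pp. 107–108)] -/
theorem exists_iso_pullback_torsion (N : ℕ) :
    ∃ φ : (Over.pullback g).obj (A.torsion N) ≅ (A.baseChange g).torsion N,
      φ.hom ≫ (A.baseChange g).torsionι N = (Over.pullback g).map (A.torsionι N) := by
  have h1 := isPullback_map_of_isPullback_unit g (A.isPullback_torsionι N)
  rw [mulN_def, pullback_map_pow, (Over.pullback g).map_id] at h1
  have h2 : IsPullback ((A.baseChange g).torsionι N) (toUnit _)
      (((𝟙 ((Over.pullback g).obj A.X) : _ ⟶ _) ^ N : (Over.pullback g).obj A.X ⟶ (Over.pullback g).obj A.X))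
      η[(Over.pullback g).obj A.X] :=
    (A.baseChange g).isPullback_torsionι N
  exact ⟨h1.isoIsPullback _ _ h2, IsPullback.isoIsPullback_hom_fst _ _ _ _⟩

/-! ## §3 … compatibly with the torsion maps of a ring action -/

namespace RingAction

variable {O : Type v} [CommRing O] (act : RingAction O A)

/-- **`𝒜[N] ×_S S′ ≅ (𝒜 ×_S S′)[N]` intertwines `ι(r)[N] ×_S S′` and `ι_{S′}(r)[N]`**: both restrict `ι(r) ×_S S′` on `𝒜 ×_S S′`
(★ `torsionMap_ι`, ★ `RingAction.baseChange_i`), along `ι[N] ×_S S′` resp. the monomorphism `ι_{S′}[N]` (§1 `comp_eq_comp_of_restrict`).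
[cite: Kottwitz1992, §5 (p. 390)] [cite: Tate1967, §2 (2.1)] -/
theorem exists_iso_pullback_torsion_comm_torsionMap (r : O) (N : ℕ) :
    ∃ φ : (Over.pullback g).obj (A.torsion N) ≅ (A.baseChange g).torsion N,
      φ.hom ≫ (A.baseChange g).torsionι N = (Over.pullback g).map (A.torsionι N) ∧
      φ.hom ≫ (haveI := (act.baseChange g).isMonHom_i r; torsionMap ((act.baseChange g).i r) N) =
        (Over.pullback g).map (haveI := act.isMonHom_i r; torsionMap (act.i r) N) ≫ φ.hom := by
  obtain ⟨φ, hφ⟩ := A.exists_iso_pullback_torsion g N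
  haveI := act.isMonHom_i r
  haveI := (act.baseChange g).isMonHom_i r
  haveI := (A.baseChange g).mono_torsionι N
  refine ⟨φ, hφ, comp_eq_comp_of_restrict (ψ := (Over.pullback g).map (act.i r)) φ.hom hφ ?_ ?_⟩
  · rw [← Functor.map_comp, torsionMap_ι, Functor.map_comp]
  · rw [torsionMap_ι, RingAction.baseChange_i]

/-! ## §4 The socket (S-H): block height on the special fibre from the count at the generic geometric fibre -/

/-- **`hrank` ON THE LOCAL BASE from the count at a geometric point, in the currency of the fibre.**  `𝒜` over a local `Spec R₀` with
`act : RingAction O 𝒜`, `p ≠ 0`, a compatible family `a` (`aₙ₊₁ ≡ aₙ`, `aₙ² ≡ aₙ (mod pⁿ)`), `gΩ : Spec Ω → Spec R₀` with `Ω = Ω̄`,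
`(p : Ω) ≠ 0`: if `#{x ∈ 𝒜_Ω[pⁿ](Ω) | x ≫ ι_Ω(aₙ)[pⁿ] = x} = p^{n h}` for all `n`, then the fixed part of `ε₀ := β₀(a)` on `𝒜[p^∞]` has
`rk_s (Fix ε₀)_n = p^{n h}` at every `s ∈ Spec R₀` (FILE A ★ `hrank_pDivisibleGroup_of_natCard_fixedPoints`, the count moved along §3 by
`natCard_fixedPoints_eq_of_iso`). [cite: Tate1967, §2 (2.1) and (2.4)] [cite: RapoportSmithlingZhang2020Diagonal, §4.1 (p. 17)]
[cite: StacksProject, Tag 02KA] -/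
theorem hrank_of_natCard_fixedPoints {R₀ : Type u} [CommRing R₀] [IsLocalRing R₀] {𝒜 : AbelianSchemeOver (Spec (.of R₀))}
    [IsCommMonObj 𝒜.X] {p g : ℕ} (hp : p ≠ 0) (hg : 𝒜.IsOfRelDim g) (act : RingAction O 𝒜) (a : ℕ → O)
    (ha : ∀ n, a (n + 1) - a n ∈ Ideal.span {(p : O) ^ n}) (ha2 : ∀ n, a n * a n - a n ∈ Ideal.span {(p : O) ^ n})
    {Ω : Type u} [Field Ω] [IsAlgClosed Ω] (gΩ : Spec (.of Ω) ⟶ Spec (.of R₀)) (hpΩ : (p : Ω) ≠ 0) [IsCommMonObj (𝒜.baseChange gΩ).X]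
    {h : ℕ}
    (hcount : ∀ n, Nat.card {x : 𝟙_ (Over (Spec (.of Ω))) ⟶ (𝒜.baseChange gΩ).torsion (p ^ n) //
      x ≫ (haveI := (act.baseChange gΩ).isMonHom_i (a n); torsionMap ((act.baseChange gΩ).i (a n)) (p ^ n)) = x} = p ^ (n * h))
    (n : ℕ) (s : ↥(Spec (.of R₀))) :
    (((isRingActionBT_pDivisibleGroupMap act hp hg).homOfCompatibleFamily a ha).fixLayer n).hom.finrank s = p ^ (n * h) := by
  refine hrank_pDivisibleGroup_of_natCard_fixedPoints 𝒜 hp hg _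
    ((isRingActionBT_pDivisibleGroupMap act hp hg).homOfCompatibleFamily_idem a ha ha2) gΩ hpΩ (fun m => ?_) n s
  obtain ⟨φ, -, hφ⟩ := exists_iso_pullback_torsion_comm_torsionMap 𝒜 gΩ act (a m) (p ^ m)
  rw [← hcount m]
  exact natCard_fixedPoints_eq_of_iso _ φ hφ

/-- **THE SOCKET (S-H) — BLOCK HEIGHT ON THE SPECIAL FIBRE FROM THE GENERIC FIBRE.**  `𝒜` an abelian scheme over a local `Spec R₀` with a
ring action `act : RingAction O 𝒜`, `p ≠ 0`, `a : ℕ → O` the compatible idempotent family of the `w`-block (`aₙ₊₁ ≡ aₙ`, `aₙ² ≡ aₙ (mod pⁿ)`),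
`gΩ : Spec Ω → Spec R₀` a geometric point with `(p : Ω) ≠ 0` (the geometric GENERIC fibre in characteristic `0`) and `gκ : Spec κ → Spec R₀`
any field-valued point (the SPECIAL fibre).  If for every `n` the number of `Ω`-points `x` of `𝒜_Ω[pⁿ]` with `x ≫ ι_Ω(aₙ)[pⁿ] = x` is `p^{n h}`
(in characteristic `0`: `#(e_w · 𝒜_Ω[pⁿ](Ω)) = p^{n h}`, `h = 2 e f` from `T_p 𝒜_Ω` free over `O ⊗ ℤ_p`), then the fixed part of the idempotent
`ε_κ := β_κ(a)` of `𝒜_κ[p^∞]` (`β_κ r := ι_κ(r)[p^∞]`, ★ `isRingActionBT_pDivisibleGroupMap (act.baseChange gκ)`) has rank `p^{n h}` in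
every layer: the hypothesis `hrank` of ★ `PDivisibleGroupBlockDocking` ∕ ★ `fixBTGroup` for `A := 𝒜.baseChange gκ` — `Fix ε_κ = 𝒜_κ[w^∞]` is a
Barsotti–Tate group of height `h` (`hrank_of_natCard_fixedPoints` on `Spec R₀`; ★ `hrank_baseChange gκ`; §1 `finrank_fix_hom_eq_of_iso` along
§3 at `gκ`). [cite: Tate1967, §2 (2.1) and (2.4)] [cite: Messing1972, Ch. I (1.1)–(1.6)] [cite: RapoportSmithlingZhang2020Diagonal, §4.1 (p. 17)] -/
theorem hrank_specialFibre_of_natCard_fixedPoints {R₀ : Type u} [CommRing R₀] [IsLocalRing R₀]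
    {𝒜 : AbelianSchemeOver (Spec (.of R₀))} [IsCommMonObj 𝒜.X] {p g : ℕ} (hp : p ≠ 0) (hg : 𝒜.IsOfRelDim g) (act : RingAction O 𝒜)
    (a : ℕ → O) (ha : ∀ n, a (n + 1) - a n ∈ Ideal.span {(p : O) ^ n}) (ha2 : ∀ n, a n * a n - a n ∈ Ideal.span {(p : O) ^ n})
    {Ω : Type u} [Field Ω] [IsAlgClosed Ω] (gΩ : Spec (.of Ω) ⟶ Spec (.of R₀)) (hpΩ : (p : Ω) ≠ 0) [IsCommMonObj (𝒜.baseChange gΩ).X]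
    {κ : Type u} [Field κ] (gκ : Spec (.of κ) ⟶ Spec (.of R₀)) [IsCommMonObj (𝒜.baseChange gκ).X] {h : ℕ}
    (hcount : ∀ n, Nat.card {x : 𝟙_ (Over (Spec (.of Ω))) ⟶ (𝒜.baseChange gΩ).torsion (p ^ n) //
      x ≫ (haveI := (act.baseChange gΩ).isMonHom_i (a n); torsionMap ((act.baseChange gΩ).i (a n)) (p ^ n)) = x} = p ^ (n * h))
    (n : ℕ) (s : ↥(Spec (.of κ))) :
    (((isRingActionBT_pDivisibleGroupMap (act.baseChange gκ) hp (hg.baseChange gκ)).homOfCompatibleFamily a ha).fixLayer n).hom.finrank s =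
      p ^ (n * h) := by
  -- `hrank` for `ε₀` on `Spec R₀`, then for `ε₀ ×_{R₀} κ` on `Spec κ`
  have h0 := hrank_baseChange gκ ((isRingActionBT_pDivisibleGroupMap act hp hg).homOfCompatibleFamily a ha)
    ((isRingActionBT_pDivisibleGroupMap act hp hg).homOfCompatibleFamily_idem a ha ha2) h
    (hrank_of_natCard_fixedPoints hp hg act a ha ha2 gΩ hpΩ hcount) n s
  rw [← h0]
  -- the layer isomorphism `𝒜[pⁿ] ×_{R₀} κ ≅ 𝒜_κ[pⁿ]` intertwines the two idempotents
  obtain ⟨φ, -, hφ⟩ := exists_iso_pullback_torsion_comm_torsionMap 𝒜 gκ act (a n) (p ^ n)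
  letI : GrpObj ((Over.pullback gκ).obj (𝒜.torsion (p ^ n))) := ((𝒜.pDivisibleGroup hp hg).baseChange gκ).grpObj n
  letI : GrpObj ((𝒜.baseChange gκ).torsion (p ^ n)) := ((𝒜.baseChange gκ).pDivisibleGroup hp (hg.baseChange gκ)).grpObj n
  haveI : IsFinite ((𝒜.baseChange gκ).torsion (p ^ n)).hom := (𝒜.baseChange gκ).isFinite_torsion_hom (pow_ne_zero n hp)
  haveI : Flat ((𝒜.baseChange gκ).torsion (p ^ n)).hom := (𝒜.baseChange gκ).flat_torsion_hom (pow_ne_zero n hp)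
  exact (finrank_fix_hom_eq_of_iso _ _ φ hφ
    ((isRingActionBT_pDivisibleGroupMap (act.baseChange gκ) hp (hg.baseChange gκ)).homOfCompatibleFamily_idem a ha ha2 n) s).symm

end RingAction

end AbelianSchemeOver

end Literature.AlgebraicGeometry.AbelianSchemes

end
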